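import Summits.ValiantsHypothesis.ValiantsHypothesis.Theorems.LangWeilTransferTameTransfer
import Summits.ValiantsHypothesis.ValiantsHypothesis.Theorems.LangWeilTransferAssembly
import Summits.ValiantsHypothesis.ValiantsHypothesis.Theorems.LangWeilTransferUniversalGlue
import Summits.ValiantsHypothesis.ValiantsHypothesis.Theorems.LangWeilTransferShatteringExclusionComponentDescent

/-!
# LangWeilTransfer — the summit from EXACTLY the route's remaining open statements
# (record after Theorem T and the component descent)

Route `LangWeilTransfer` of `ValiantsHypothesis`. After `tameTransfer_proof` (THEOREM T, crux
stmt-6373, with `GoodReduction` stmt-6377 and `TameResolution` stmt-6378 proved) every SUPPORT item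
of the route is a theorem of the tree, and the deciding theorem `closes` rests on precisely the two
research problems the thesis names: the crux `ShatteringExclusion` (stmt-6372) — or its structural
strengthening `UniversalTameness` (stmt-6374) via `UniversalGlue` — and the Boolean conjecture
`SharpPNotPPoly` (stmt-6381, `P^#P ⊄ P/poly`):

* `valiantsHypothesis_of_shatteringExclusion_of_sharpPNotPPoly`,
* `valiantsHypothesis_of_universalTameness_of_sharpPNotPPoly`.

Inside the crux, the registered line `Cruxes/ShatteringExclusion/Lines/birth.lean` cuts
`ShatteringExclusion` into constant descent for the permanent (`LowDegreeConstants`, open-problem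
grade), unibranching (`Unibranching`, conjecture grade) and the Galois descent of a unibranch
component, which is now a theorem (`ShatteringExclusion.stub_componentDescent`,
`…ShatteringExclusionComponentDescent.lean`); so

* `shatteringExclusion_of_lowDegreeConstants_of_unibranching` — the line's composition with the
  descent discharged (its two hypotheses are the bodies of the line's `LowDegreeConstants` and
  `Unibranching`, verbatim), and
* `valiantsHypothesis_of_lowDegreeConstants_of_unibranching_of_sharpPNotPPoly` — the summit from
  exactly the three statements that remain open on this route tonight.

This supersedes the four-hypothesis record `valiantsHypothesis_of_open_cruxes`
(`LangWeilTransferOpenCruxes.lean`). Honest framing: CONDITIONAL statements; all hypotheses are open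
research problems (SE / constant elimination / unibranching; `P^#P ⊄ P/poly`); `VP ≠ VNP` is NOT
proved and nothing here is progress on it.
-/

noncomputable section

-- the summit and the problem share the name `ValiantsHypothesis` (D-0017 single-conjunct layout)
set_option linter.dupNamespace false

namespace Summit.ValiantsHypothesis.ValiantsHypothesis.Theorems.LangWeilTransfer

open Summit.ValiantsHypothesis.ValiantsHypothesis.Theses.LangWeilTransfer

/-- **`ValiantsHypothesis` from the crux and the Boolean conjunct only**:
`ShatteringExclusion → ¬(P^#P ⊆ P/poly) → ValiantsHypothesis` (`closes` with `TameTransfer`,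
`ScalarRestriction`, `Assembly` discharged by tree theorems). Conditional bookkeeping only. -/
theorem valiantsHypothesis_of_shatteringExclusion_of_sharpPNotPPoly (hSE : ShatteringExclusion)
    (hB : SharpPNotPPoly) : _root_.ValiantsHypothesis :=
  closes hSE tameTransfer_proof scalarRestriction_proof hB assembly_proof

/-- **`ValiantsHypothesis` from Galois-tameness of algebraic computation and the Boolean conjunct**:
`UniversalTameness → ¬(P^#P ⊆ P/poly) → ValiantsHypothesis` (through `UniversalGlue`).
Conditional bookkeeping only. -/
theorem valiantsHypothesis_of_universalTameness_of_sharpPNotPPoly (hUT : UniversalTameness)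
    (hB : SharpPNotPPoly) : _root_.ValiantsHypothesis :=
  valiantsHypothesis_of_shatteringExclusion_of_sharpPNotPPoly (universalGlue_proof hUT) hB

/-- **The crux from the two open stubs of its registered line**: constant descent for the permanent
(`LowDegreeConstants`, the body verbatim as the first hypothesis) and unibranching (`Unibranching`,
verbatim as the second) imply `ShatteringExclusion`, the Galois descent of the unibranch component
being the tree theorem `ShatteringExclusion.stub_componentDescent` (the line's composition
`ShatteringExclusion_of` with its third stub discharged: `c' = c₂`, `d₀ = d₂`, `N = max N₁ N₂`).
Conditional bookkeeping only. -/
theorem shatteringExclusion_of_lowDegreeConstants_of_unibranching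
    (hA : ∀ c : ℕ, ∃ c' d₀ N : ℕ, ∀ n ≥ N,
      (∃ P : Literature.Computability.AlgebraicComplexity.ArithCircuit ℂ (Fin n × Fin n),
      P.IsFanInTwo ∧ P.size ≤ n ^ c ∧
      P.Computes (Literature.Computability.AlgebraicComplexity.perPoly (Fin n) ℂ)) →
      ∃ P : Literature.Computability.AlgebraicComplexity.ArithCircuit ℂ (Fin n × Fin n),
      P.IsFanInTwo ∧ P.size ≤ n ^ c' ∧
      P.Computes (Literature.Computability.AlgebraicComplexity.perPoly (Fin n) ℂ) ∧
      ∃ K : IntermediateField ℚ ℂ, FiniteDimensional ℚ K ∧ Module.finrank ℚ K ≤ n ^ d₀ ∧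
      ∀ v : Fin (4 * P.size + 1), Literature.Computability.AlgebraicComplexity.slotConst P v ∈ K)
    (hB : ∀ c d₀ : ℕ, ∃ c' d₀' N : ℕ, ∀ n ≥ N,
      (∃ P : Literature.Computability.AlgebraicComplexity.ArithCircuit ℂ (Fin n × Fin n),
      P.IsFanInTwo ∧ P.size ≤ n ^ c ∧
      P.Computes (Literature.Computability.AlgebraicComplexity.perPoly (Fin n) ℂ) ∧
      ∃ K : IntermediateField ℚ ℂ, FiniteDimensional ℚ K ∧ Module.finrank ℚ K ≤ n ^ d₀ ∧
      ∀ v : Fin (4 * P.size + 1),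
      Literature.Computability.AlgebraicComplexity.slotConst P v ∈ K) →
      ∃ P : Literature.Computability.AlgebraicComplexity.ArithCircuit ℂ (Fin n × Fin n),
      P.IsFanInTwo ∧ P.size ≤ n ^ c' ∧
      P.Computes (Literature.Computability.AlgebraicComplexity.perPoly (Fin n) ℂ) ∧
      ∃ K : IntermediateField ℚ ℂ, FiniteDimensional ℚ K ∧ Module.finrank ℚ K ≤ n ^ d₀' ∧
      (∀ v : Fin (4 * P.size + 1),
      Literature.Computability.AlgebraicComplexity.slotConst P v ∈ K) ∧
      ∃! 𝔓 : Ideal (MvPolynomial (Fin (4 * P.size + 1)) ℂ),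
      𝔓 ∈ ((Ideal.span (Set.range fun α : (Fin n × Fin n) →₀ ℕ =>
      MvPolynomial.map (Int.castRingHom ℚ) (MvPolynomial.coeff α
      (MvPolynomial.sumAlgEquiv ℤ (Fin n × Fin n) (Fin (4 * P.size + 1))
      (Literature.Computability.AlgebraicComplexity.skeleton P).eval) -
      MvPolynomial.C (MvPolynomial.coeff α
      (Literature.Computability.AlgebraicComplexity.perPoly (Fin n) ℤ))))).map
      (MvPolynomial.map (algebraMap ℚ ℂ))).minimalPrimes ∧
      𝔓 ≤ RingHom.ker (MvPolynomial.aeval (R := ℂ)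
      (fun v : Fin (4 * P.size + 1) =>
      Literature.Computability.AlgebraicComplexity.slotConst P v))) :
    ShatteringExclusion := by
  intro c
  obtain ⟨c₁, d₁, N₁, hA'⟩ := hA c
  obtain ⟨c₂, d₂, N₂, hB'⟩ := hB c₁ d₁
  refine ⟨c₂, d₂, max N₁ N₂, fun n hn hP => ?_⟩
  obtain ⟨P, hP2, hPs, hPc, K, hKfd, hKrk, hKmem, huniq⟩ :=
    hB' n (le_trans (le_max_right N₁ N₂) hn) (hA' n (le_trans (le_max_left N₁ N₂) hn) hP)
  exact ⟨P, hP2, hPs, hPc, _, rfl,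
    ShatteringExclusion.stub_componentDescent (4 * P.size + 1) (n ^ d₂) _
      (fun v : Fin (4 * P.size + 1) => Literature.Computability.AlgebraicComplexity.slotConst P v)
      K hKfd hKrk hKmem huniq⟩

/-- **`ValiantsHypothesis` from exactly the three statements left open on route LangWeilTransfer**:
constant descent for the permanent, unibranching, and `¬(P^#P ⊆ P/poly)`. Conditional bookkeeping
only; all three hypotheses are open. -/
theorem valiantsHypothesis_of_lowDegreeConstants_of_unibranching_of_sharpPNotPPoly
    (hA : ∀ c : ℕ, ∃ c' d₀ N : ℕ, ∀ n ≥ N,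
      (∃ P : Literature.Computability.AlgebraicComplexity.ArithCircuit ℂ (Fin n × Fin n),
      P.IsFanInTwo ∧ P.size ≤ n ^ c ∧
      P.Computes (Literature.Computability.AlgebraicComplexity.perPoly (Fin n) ℂ)) →
      ∃ P : Literature.Computability.AlgebraicComplexity.ArithCircuit ℂ (Fin n × Fin n),
      P.IsFanInTwo ∧ P.size ≤ n ^ c' ∧
      P.Computes (Literature.Computability.AlgebraicComplexity.perPoly (Fin n) ℂ) ∧
      ∃ K : IntermediateField ℚ ℂ, FiniteDimensional ℚ K ∧ Module.finrank ℚ K ≤ n ^ d₀ ∧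
      ∀ v : Fin (4 * P.size + 1), Literature.Computability.AlgebraicComplexity.slotConst P v ∈ K)
    (hB : ∀ c d₀ : ℕ, ∃ c' d₀' N : ℕ, ∀ n ≥ N,
      (∃ P : Literature.Computability.AlgebraicComplexity.ArithCircuit ℂ (Fin n × Fin n),
      P.IsFanInTwo ∧ P.size ≤ n ^ c ∧
      P.Computes (Literature.Computability.AlgebraicComplexity.perPoly (Fin n) ℂ) ∧
      ∃ K : IntermediateField ℚ ℂ, FiniteDimensional ℚ K ∧ Module.finrank ℚ K ≤ n ^ d₀ ∧
      ∀ v : Fin (4 * P.size + 1),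
      Literature.Computability.AlgebraicComplexity.slotConst P v ∈ K) →
      ∃ P : Literature.Computability.AlgebraicComplexity.ArithCircuit ℂ (Fin n × Fin n),
      P.IsFanInTwo ∧ P.size ≤ n ^ c' ∧
      P.Computes (Literature.Computability.AlgebraicComplexity.perPoly (Fin n) ℂ) ∧
      ∃ K : IntermediateField ℚ ℂ, FiniteDimensional ℚ K ∧ Module.finrank ℚ K ≤ n ^ d₀' ∧
      (∀ v : Fin (4 * P.size + 1),
      Literature.Computability.AlgebraicComplexity.slotConst P v ∈ K) ∧
      ∃! 𝔓 : Ideal (MvPolynomial (Fin (4 * P.size + 1)) ℂ),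
      𝔓 ∈ ((Ideal.span (Set.range fun α : (Fin n × Fin n) →₀ ℕ =>
      MvPolynomial.map (Int.castRingHom ℚ) (MvPolynomial.coeff α
      (MvPolynomial.sumAlgEquiv ℤ (Fin n × Fin n) (Fin (4 * P.size + 1))
      (Literature.Computability.AlgebraicComplexity.skeleton P).eval) -
      MvPolynomial.C (MvPolynomial.coeff α
      (Literature.Computability.AlgebraicComplexity.perPoly (Fin n) ℤ))))).map
      (MvPolynomial.map (algebraMap ℚ ℂ))).minimalPrimes ∧
      𝔓 ≤ RingHom.ker (MvPolynomial.aeval (R := ℂ)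
      (fun v : Fin (4 * P.size + 1) =>
      Literature.Computability.AlgebraicComplexity.slotConst P v)))
    (hC : SharpPNotPPoly) : _root_.ValiantsHypothesis :=
  valiantsHypothesis_of_shatteringExclusion_of_sharpPNotPPoly
    (shatteringExclusion_of_lowDegreeConstants_of_unibranching hA hB) hC

end Summit.ValiantsHypothesis.ValiantsHypothesis.Theorems.LangWeilTransfer

end
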